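import Summits.BirchSwinnertonDyer.BirchSwinnertonDyer.Theorems.ResidualThetaTransportAtTwoResidualSignedLambdaLowerCMAtTwoCofreeTorsionScalar
import Summits.BirchSwinnertonDyer.BirchSwinnertonDyer.Theorems.ResidualThetaTransportAtTwoResidualSignedLambdaLowerCMAtTwoLayerPairingAdjoint
import Summits.BirchSwinnertonDyer.BirchSwinnertonDyer.Theorems.ResidualThetaTransportAtTwoResidualSignedLambdaLowerCMAtTwoDlocPadicModule
import HarnessLib

/-!
# The scalar `a ∈ 𝒪` moves through the S₀-side value pin: `DlocSMul ∘ j = j ∘ (a·)_*`, `red_{2^k}(a • y) = (a·)_* red_{2^k}(y)`, and the one-pair tower is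
# `𝒪`-balanced — `⟨red(conj(proj((C a) • x))), y⟩ = ⟨red(conj(proj x)), (a·)_* y⟩` (the input of `AwayPins.hlocdS_smul`)

Route `ResidualThetaTransportAtTwo` (RTT), crux RSL_g `ResidualSignedLambdaLowerCMAtTwo` (stmt-BirchSwinnertonDyer-22608), line «onepair» (v3d), GLUE-SPEC-g18 T2(b) E3
(`AwayPins` existence, LEAD rtt-p2 g19, STATUS 07:32:10Z: «𝒪-balance of the layer pairing ⟨a•b, y⟩ = ⟨b, a•y⟩», «`hlocdS_smul` from `dlocModule_smul_def` +
coefficient naturality»). Seat `prover-bsd-wall-tp2-p2x-w2` g20 (`--supports`, closes nothing). THEOREMS ONLY. BSD is not proved by any of this.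

* §1 `OnePairPins.ePk_cofreeTorsionScalar_comm` — `e_k(a·x, y) = e_k(x, a·y)` (`ePk_smul_comm` + `cofreeTorsionScalar_divPowCofreeMkTorsion`).
* §2 `DlocSMul_jAway` — `DlocSMul w a (j_{n,k} y) = j_{n,k} ((a·)_* y)` (both are the class of `τ ↦ a • y(τ)`);
  `reduceH1CofreePkTorsion_smul` — `red_{2^k}(a • b) = (a·)_* red_{2^k}(b)` on `H¹(U, T_ρ)` (`div_k(a t) = a · div_k t`).
* §3 **`layerPairingOf_reduce_conjMap_proj_C_smul`** — for `x ∈ 𝐇¹`, `a ∈ 𝒪`, `σ`, `m`, `k`, `y ∈ H¹(U_{m,w}, A_ρ[2^k]|)`: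
  `⟨red_{2^k}(conj_σ(proj_m((C a) • x))), y⟩_{m,2^k} = ⟨red_{2^k}(conj_σ(proj_m x)), (a·)_* y⟩_{m,2^k}` for the one-pair tower `π.ePk` — `proj_C_smul`, linearity of `conjMap`,
  §2, §1 and `layerPairingOf_map_adjoint` (p706992). With `AwayPins.hlocdS`, `CharacterModule`'s `(a • χ) y = χ (a • y)`, `dlocModule_smul_def` and `DlocSMul_jAway` this
  is `hlocdS_smul` on the pinned images (then everywhere by `addMonoidHom_eq_of_jAway`, p700479).

References: [Kato2004Asterisque] §13.8 (pp. 228–229); [Greenberg1989] §1 p. 98; [NeukirchSchmidtWingberg2008] I §4 (1.4.2); [PerrinRiou1994Invent] §3.6.1.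
-/

set_option autoImplicit false
-- the Theorems namespace of this sub repeats the summit name by design (D-0017 nested layout)
set_option linter.dupNamespace false

noncomputable section

open scoped Classical

/-! ## §1 The one-pair tower is balanced for `a·` -/

namespace Summit.BirchSwinnertonDyer.BirchSwinnertonDyer.Theorems.OnePair.OnePairPins

open CategoryTheory Field NumberField IsDedekindDomain
  Literature.NumberTheory.EllipticCurves Literature.NumberTheory.GaloisRepresentations
  Literature.NumberTheory.EllipticCurves.GreenbergSelmer Literature.NumberTheory.EllipticCurves.Kobayashi2003
  Summit.BirchSwinnertonDyer.BirchSwinnertonDyer.Theorems.ThetaTransport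

variable {S : Set (PadicAlgCl 2)} {W : WeierstrassCurve ℚ} [W.IsElliptic] {κ : ZpExtension ℚ 2} {γ : absoluteGaloisGroup ℚ}
  {S₀ : Finset (HeightOneSpectrum (𝓞 ℚ))} {n : ℕ} {ρ : FramedGaloisRep ℚ ↥(padicCoeffIntegers S) 2}
  {Θ : ∀ v : HeightOneSpectrum (𝓞 ℚ), ((2 : ℕ) : 𝓞 ℚ) ∈ v.asIdeal → (Cofree ρ ↥(padicCoeffField S) ≃+ (Fin n → ↥(W.geomPrimaryTorsion 2)))}
  {hΘ : ∀ v hv (δ : absoluteGaloisGroup (v.adicCompletion ℚ)) m i,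
    Θ v hv (resGalOfEmb (closureEmb (K := ℚ) (v.adicCompletion ℚ)) δ • m) i = resGalOfEmb (closureEmb (K := ℚ) (v.adicCompletion ℚ)) δ • Θ v hv m i}
  {I : Kato2004.IwasawaH1DataCoeff (FramedGaloisRep.toGaloisRep ρ) 2 κ γ}
  {Sg : AddSubgroup (subgroupH1 κ.kerSubgroup (Cofree ρ ↥(padicCoeffField S)))} [Module ↥(padicCoeffIntegers S) ↥Sg]
  (π : OnePairPins S W κ γ S₀ n ρ Θ hΘ I Sg)

/-- **`e_k(a · x, y) = e_k(x, a · y)`** for the one-pair tower and the scalar endomorphism `cofreeTorsionScalar` (`T_ρ/2^k ↠ A_ρ[2^k]`, `ePk_smul_comm`).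
[cite: Kato2004Asterisque, §13.8 (pp. 228–229)] -/
theorem ePk_cofreeTorsionScalar_comm (k : ℕ) (a : ↥(padicCoeffIntegers S))
    (x y : ↥(AddSubgroup.torsionBy (Cofree ρ ↥(padicCoeffField S)) ((2 ^ k : ℕ) : ℤ))) :
    π.ePk k ((cofreeTorsionScalar S ρ ((2 ^ k : ℕ) : ℤ) a).hom x) y = π.ePk k x ((cofreeTorsionScalar S ρ ((2 ^ k : ℕ) : ℤ) a).hom y) := by
  obtain ⟨s, rfl⟩ := divPowCofreeMkTorsion_surjective S ρ k x
  obtain ⟨t, rfl⟩ := divPowCofreeMkTorsion_surjective S ρ k y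
  rw [cofreeTorsionScalar_divPowCofreeMkTorsion, cofreeTorsionScalar_divPowCofreeMkTorsion, ePk_smul_comm]

end Summit.BirchSwinnertonDyer.BirchSwinnertonDyer.Theorems.OnePair.OnePairPins

namespace Summit.BirchSwinnertonDyer.BirchSwinnertonDyer.Theorems.ThetaTransport

open CategoryTheory Field NumberField IsDedekindDomain
  Literature.NumberTheory.EllipticCurves Literature.NumberTheory.GaloisRepresentations
  Literature.NumberTheory.EllipticCurves.GreenbergSelmer Literature.NumberTheory.EllipticCurves.CyclotomicLayer
  Literature.NumberTheory.EllipticCurves.Kato2004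
  Summit.BirchSwinnertonDyer.BirchSwinnertonDyer.Theorems.OnePair

/-! ## §2 Naturality of the frame maps in the scalar -/

section Frame

variable (S : Set (PadicAlgCl 2)) (κ : ZpExtension ℚ 2) (ρ : FramedGaloisRep ℚ ↥(padicCoeffIntegers S) 2) (w : HeightOneSpectrum (𝓞 ℚ))

-- `cohomologyMap_oneCocycleClass` through `jAway`'s two-step composite unfolds at the 200k edge (fails at 150k) — guard per ops bf3-g32 habit note
set_option maxHeartbeats 400000 in
/-- **`DlocSMul w a ∘ j_{n,k} = j_{n,k} ∘ (a·)_*`**: the functorial scalar on `D_w` and the scalar endomorphism of the layer coefficients agree through `jAway`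
(both sides are the class of `τ ↦ a • y(τ)`). [cite: Greenberg1989, §1 p. 98] [cite: SerreGaloisCohomology1997, I §2.2] -/
theorem DlocSMul_jAway (a : ↥(padicCoeffIntegers S)) (n k : ℕ) (y : Dlev S κ ρ w n k) :
    DlocSMul S κ ρ w a (jAway S κ ρ w n k y) =
      jAway S κ ρ w n k (cohomologyMap (subgroupRepMap (cofreeTorsionLocalScalar S ρ ((2 ^ k : ℕ) : ℤ) a w) (layerGroup κ w n)) 1 y) := by
  obtain ⟨ψ, rfl⟩ := oneCocycleClass_surjective _ y
  rw [jAway_apply, resLe_oneCocycleClass, cohomologyMap_oneCocycleClass, DlocSMul_oneCocycleClass, cohomologyMap_oneCocycleClass, jAway_apply,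
    resLe_oneCocycleClass, cohomologyMap_oneCocycleClass]
  exact congrArg _ (Subtype.ext (ContinuousMap.ext fun _ ↦ rfl))

/-- **`red_{2^k}(a • b) = (a·)_* red_{2^k}(b)`** on `H¹(U, T_ρ)`: the reduction `T_ρ → A_ρ[2^k]` is `𝒪`-linear (`div_k(a t) = a · div_k t`).
[cite: Kato2004Asterisque, §13.8 (p. 228)] -/
theorem reduceH1CofreePkTorsion_smul (k : ℕ) (U : Subgroup (absoluteGaloisGroup ℚ)) (a : ↥(padicCoeffIntegers S))
    (b : H1 (FramedGaloisRep.toGaloisRep ρ) U) :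
    (reduceH1CofreePkTorsion S ρ k U (a • b) : H1 (cofreeTorsionGaloisModule S ρ ((2 ^ k : ℕ) : ℤ)) U) =
      cohomologyMap (subgroupRepMap (cofreeTorsionScalar S ρ ((2 ^ k : ℕ) : ℤ) a) U) 1
        (reduceH1CofreePkTorsion S ρ k U b : H1 (cofreeTorsionGaloisModule S ρ ((2 ^ k : ℕ) : ℤ)) U) := by
  obtain ⟨φ, rfl⟩ := oneCocycleClass_surjective _ b
  rw [← oneCocycleClass_smul]
  have h2 := reduceH1CofreePkTorsion_oneCocycleClass S ρ k U (a • φ)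
  have h3 := reduceH1CofreePkTorsion_oneCocycleClass S ρ k U φ
  refine h2.trans ?_
  refine Eq.trans ?_ (congrArg (cohomologyMap (subgroupRepMap (cofreeTorsionScalar S ρ ((2 ^ k : ℕ) : ℤ) a) U) 1) h3).symm
  refine Eq.trans ?_ (cohomologyMap_oneCocycleClass _ _).symm
  exact congrArg _ (Subtype.ext (ContinuousMap.ext fun g ↦ (cofreeTorsionScalar_divPowCofreeMkTorsion S ρ a k (φ.1 g)).symm))

end Frame

/-! ## §3 The one-pair value pin is `𝒪`-balanced -/

section Balance

variable {S : Set (PadicAlgCl 2)} {W : WeierstrassCurve ℚ} [W.IsElliptic] {κ : ZpExtension ℚ 2} {γ : absoluteGaloisGroup ℚ}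
  {S₀ : Finset (HeightOneSpectrum (𝓞 ℚ))} {n : ℕ} {ρ : FramedGaloisRep ℚ ↥(padicCoeffIntegers S) 2}
  {Θ : ∀ v : HeightOneSpectrum (𝓞 ℚ), ((2 : ℕ) : 𝓞 ℚ) ∈ v.asIdeal → (Cofree ρ ↥(padicCoeffField S) ≃+ (Fin n → ↥(W.geomPrimaryTorsion 2)))}
  {hΘ : ∀ v hv (δ : absoluteGaloisGroup (v.adicCompletion ℚ)) m i,
    Θ v hv (resGalOfEmb (closureEmb (K := ℚ) (v.adicCompletion ℚ)) δ • m) i = resGalOfEmb (closureEmb (K := ℚ) (v.adicCompletion ℚ)) δ • Θ v hv m i}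
  {I : Kato2004.IwasawaH1DataCoeff (FramedGaloisRep.toGaloisRep ρ) 2 κ γ}
  {Sg : AddSubgroup (subgroupH1 κ.kerSubgroup (Cofree ρ ↥(padicCoeffField S)))} [Module ↥(padicCoeffIntegers S) ↥Sg]
  (π : OnePairPins S W κ γ S₀ n ρ Θ hΘ I Sg)

-- the coercion towers `𝐇¹ → H¹(Γ_m, T_ρ) → H¹(Γ_m, A_ρ[2^k])` between the cohomology dialects exceed the default budget (as in `…CofreeSelmerTransferKummer`)
set_option maxHeartbeats 1600000 in
/-- **The S₀-side value pin is `𝒪`-balanced.** For `x ∈ 𝐇¹`, `a ∈ 𝒪`, a coset representative `σ`, a layer `m`, a level `k` and `y ∈ H¹(U_{m,w}, A_ρ[2^k]|)`: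
`⟨red_{2^k}(conj_σ(proj_m((C a) • x))), y⟩_{m,2^k} = ⟨red_{2^k}(conj_σ(proj_m x)), (a·)_* y⟩_{m,2^k}` for the one-pair tower `e_k = π.ePk k`
(`proj_C_smul`, `conjMap` linear, `reduceH1CofreePkTorsion_smul`, `layerPairingOf_map_adjoint`, `ePk_cofreeTorsionScalar_comm`). This is `AwayPins.hlocdS_smul`
read on the pinned images `jAway` (`hlocdS`, `(a • χ) y = χ (a • y)`, `dlocModule_smul_def`, `DlocSMul_jAway`). [cite: Kato2004Asterisque, §13.8 (pp. 228–229)]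
[cite: NeukirchSchmidtWingberg2008, I §4 (1.4.2)] [cite: PerrinRiou1994Invent, §3.6.1] -/
theorem layerPairingOf_reduce_conjMap_proj_C_smul (a : ↥(padicCoeffIntegers S)) (x : I.H) (σ : absoluteGaloisGroup ℚ) (w : HeightOneSpectrum (𝓞 ℚ))
    (m k : ℕ) (y : Dlev S κ ρ w m k) :
    layerPairingOf (cofreeTorsionGaloisModule S ρ ((2 ^ k : ℕ) : ℤ)) (2 ^ k) (π.ePk k) (π.hμPk k) (π.hadd₁Pk k) (π.hadd₂Pk k) (π.hgalPk k) κ w m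
        (reduceH1CofreePkTorsion S ρ k (κ.layerSubgroup m)
          (conjMap (FramedGaloisRep.toGaloisRep ρ).toTopRep (κ.layerSubgroup m) σ 1
            (I.proj m ((PowerSeries.C a : IwasawaAlgebraO S) • x))) :
          H1 (cofreeTorsionGaloisModule S ρ ((2 ^ k : ℕ) : ℤ)) (κ.layerSubgroup m)) y =
      layerPairingOf (cofreeTorsionGaloisModule S ρ ((2 ^ k : ℕ) : ℤ)) (2 ^ k) (π.ePk k) (π.hμPk k) (π.hadd₁Pk k) (π.hadd₂Pk k) (π.hgalPk k) κ w m
        (reduceH1CofreePkTorsion S ρ k (κ.layerSubgroup m)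
          (conjMap (FramedGaloisRep.toGaloisRep ρ).toTopRep (κ.layerSubgroup m) σ 1 (I.proj m x)) :
          H1 (cofreeTorsionGaloisModule S ρ ((2 ^ k : ℕ) : ℤ)) (κ.layerSubgroup m))
        (cohomologyMap (subgroupRepMap (cofreeTorsionLocalScalar S ρ ((2 ^ k : ℕ) : ℤ) a w) (layerGroup κ w m)) 1 y) := by
  rw [I.proj_C_smul, map_smul, reduceH1CofreePkTorsion_smul]
  exact layerPairingOf_map_adjoint (cofreeTorsionGaloisModule S ρ ((2 ^ k : ℕ) : ℤ)) (2 ^ k) (π.ePk k) (π.hμPk k) (π.hadd₁Pk k) (π.hadd₂Pk k)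
    (π.hgalPk k) κ w (cofreeTorsionScalar S ρ ((2 ^ k : ℕ) : ℤ) a) (cofreeTorsionLocalScalar S ρ ((2 ^ k : ℕ) : ℤ) a w)
    (fun s t ↦ π.ePk_cofreeTorsionScalar_comm k a s t) m _ y

end Balance

end Summit.BirchSwinnertonDyer.BirchSwinnertonDyer.Theorems.ThetaTransport

end
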